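import Mathlib
import Summits.Ventures.HodgeRepro2.T5CMTypeGaloisDialect
import Summits.Ventures.HodgeRepro2.Faces

/-!
# T5CMTypeFacesBridge — the two Galois-dialect readings of a CM type are the same

Tier-5 support (seat p7, cell pub-hodge-repro2).  p1's `Faces.lean` (p386499) landed FIRST the
complex conjugation `galConj E ∈ Gal(E/ℚ)` of a CM field (central, an involution), the torsor
`galEmb E τ₀ : Gal(E/ℚ) ≃ (E →+* ℂ)` (σ ↦ τ₀ ∘ σ), and the transport
`isCMType_iff_isCMTypeOn : IsCMType E Φ ↔ IsCMTypeOn (galConj E) (galEmb E τ₀ ⁻¹' Φ)`.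
`T5CMTypePlaces` / `T5CMTypeGaloisDialect` re-landed the same objects under the names `conjGal`,
`compGalC` / `galOfComplex`, and the disjoint/cover form `isCMType_iff` (twin notice on the bus).
This file identifies them, so that either landing can be cited for the other:

* `conjGal_eq_galConj`, `compGalC_eq_galEmb`, `galOfComplex_eq_galEmb_symm`,
  `image_galOfComplex_eq_preimage_galEmb`;
* `isCMTypeOn_iff_disjoint_cover`: p1's Xor form `IsCMTypeOn` and the disjoint/cover form are the
  same statement for the Galois image of `Φ`;
* `isCMType_iff_isCMTypeOn'`: `T5CMTypePlaces`' vocabulary on the left, p1's on the right.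

Priority of the landings: p1's `Faces.lean` is the prior one for every object on the complex side.
-/

namespace Summit.Ventures.HodgeRepro2.T5CMTypeFacesBridge

open IsDedekindDomain NumberField T5CMTypePlaces T5CMTypeGaloisDialect
open scoped Pointwise

variable {E : Type*} [Field E] [NumberField E] [IsCMField E]

/-- `conjGal E` (T5CMTypeGaloisDialect) is p1's `galConj E`: both act as complex conjugation
under every complex embedding. -/
theorem conjGal_eq_galConj : conjGal E = galConj E := by
  obtain ⟨φ⟩ : Nonempty (E →+* ℂ) := inferInstance
  ext x
  apply φ.injective
  rw [conjGal_apply, IsCMField.complexEmbedding_complexConj, embedding_galConj]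

section galois

variable [IsGalois ℚ E] (ιC : E →+* ℂ)

omit [IsCMField E] in
/-- `compGalC ιC` (T5CMTypePlaces) is p1's `galEmb E ιC`. -/
theorem compGalC_eq_galEmb (σ : E ≃ₐ[ℚ] E) : compGalC ιC σ = galEmb E ιC σ := by
  rw [galEmb_apply]
  rfl

omit [IsCMField E] in
/-- `galOfComplex ιC` (T5CMTypePlaces) is the inverse of p1's `galEmb E ιC`. -/
theorem galOfComplex_eq_galEmb_symm (φ : E →+* ℂ) :
    galOfComplex ιC φ = (galEmb E ιC).symm φ := by
  apply (galEmb E ιC).injective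
  rw [Equiv.apply_symm_apply, ← compGalC_eq_galEmb, compGalC_galOfComplex]

omit [IsCMField E] in
/-- The Galois image of `Φ` under `galOfComplex` is its preimage under `galEmb`. -/
theorem image_galOfComplex_eq_preimage_galEmb (Φ : Set (E →+* ℂ)) :
    galOfComplex ιC '' Φ = (galEmb E ιC) ⁻¹' Φ := by
  ext σ
  constructor
  · rintro ⟨φ, hφ, rfl⟩
    rw [Set.mem_preimage, galOfComplex_eq_galEmb_symm, Equiv.apply_symm_apply]
    exact hφ
  · intro h
    exact ⟨galEmb E ιC σ, h, by rw [galOfComplex_eq_galEmb_symm, Equiv.symm_apply_apply]⟩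

/-- p1's Xor form `IsCMTypeOn` and the disjoint/cover form of `T5CMTypeGaloisDialect.isCMType_iff`
are the same statement for the Galois image `T = galEmb ⁻¹' Φ` of a set `Φ` of embeddings. -/
theorem isCMTypeOn_iff_disjoint_cover (Φ : Set (E →+* ℂ)) :
    IsCMTypeOn (galConj E) ((galEmb E ιC) ⁻¹' Φ) ↔
      Disjoint ((galEmb E ιC) ⁻¹' Φ) (galConj E • ((galEmb E ιC) ⁻¹' Φ)) ∧
        (galEmb E ιC) ⁻¹' Φ ∪ galConj E • ((galEmb E ιC) ⁻¹' Φ) = Set.univ := by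
  rw [← isCMType_iff_isCMTypeOn E ιC Φ, isCMType_iff ιC Φ, image_galOfComplex_eq_preimage_galEmb,
    conjGal_eq_galConj]

/-- `IsCMType` in `T5CMTypePlaces`' vocabulary on the left, p1's `IsCMTypeOn` on the right. -/
theorem isCMType_iff_isCMTypeOn' (Φ : Set (E →+* ℂ)) :
    IsCMType E Φ ↔ IsCMTypeOn (conjGal E) (galOfComplex ιC '' Φ) := by
  rw [conjGal_eq_galConj, image_galOfComplex_eq_preimage_galEmb]
  exact isCMType_iff_isCMTypeOn E ιC Φ

end galois

end Summit.Ventures.HodgeRepro2.T5CMTypeFacesBridge
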